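/-
Copyright (c) 2026 the pub-hodgecm-mathlib formalisation cell (harness21).  Prover seat hodgecm-mathlib-LH4-p01 (g6); (C5)′ «LARGE» (dealer LH4-plan (g7) WORD #39,
census `F0/P3c/LH4/LH4-p01/g6/large/CENSUS-Large.v1.md`), 2026-09-02.  Twin of ★ F0P3a-p04 `UnitOrbitalIntegralInertCountJZeroLarge` in the TRACE frame.
-/
import Literature.NumberTheory.Automorphic.UnitaryThreeBorelCosetCountTrace                         -- (C3c) F0P3a-p09: criterion `…_of_rel_normForm`, adapters `…_of_forall_coord{_not,}`, `trace_fibre_coord`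
import Literature.NumberTheory.Automorphic.UnitaryThreeBorelConjugateCongruencesJZeroEqualSizeTrace   -- ★ p852035 FILE 2 LH4-p02: `not_condition_four_of_v_sub_sub_lt_normForm`, `v_eq_one_of_trace_mul_eq` (+ FILE 1 ★ p851968)
import Literature.NumberTheory.Automorphic.UnitaryThreeBorelConjugateCongruencesJZeroTwoThreeTrace    -- (3′) LH4-p01: `conditions_two_three_of_v_le_jzero_trace`
import Literature.NumberTheory.Automorphic.UnitaryThreeBorelCosetCountJZeroBoxTrace                 -- (3) LH4-p01: `natCard_cosets_of_iff_box_of_unram` (+ ★ C2-A)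
import HarnessLib

/-!
# Flicker's PROPOSITION 13 for `m > N` in the TRACE frame (every residue characteristic): the `P_H`-coset count of a `j = 0` torus element equals `iThirteen q N N₊ M m`

Topic `NumberTheory/Rogawski1990` (road «D-N7-inert», LAYER C block (C5)′); namespace `Literature.NumberTheory.Automorphic.UnitaryGroup` (= ★'s).  TWIN of ★
`UnitOrbitalIntegralInertCountJZeroLarge` (F0P3a-p04 (g12)) for the UNRAMIFIED datum and the 2-free level element `u_m^{(y,z)}`: the symmetric-frame letters
`τ = !![A,0,B;0,b,0;B,0,A]`, `(A − b)∕B = f + g` are replaced by the general corner `τ = !![A,0,B₁;0,b,0;B₂,0,D]` with the `j = 0` relations of ★ (C3b)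
`UnitaryThreeBorelConjugateCongruencesJZeroTrace` — `B₁ = κσκB₂`, `A − D = (σκ − κ)B₂`, `B₂G = (D − b − κB₂)s`, `r(κ + σκ) = b₀G + σb₀σG`, the fibre constant `s = −yσy`
(`w + σw = s` for every coset's `w = x + z`), `C := r(s + r)`, `Δ := G − σG`, `X := κν⁻¹ + w + r` — and the exponent dictionary `|B| = |ϖ^N| ↦ |B₂| = |ϖ^N|`,
`|g| = |ϖ^M| ↦ |G − σG| = |ϖ^M|`, `|f² − 1| = |ϖ^{M−N}| ↦ |r(s + r)| = |ϖ^{M−N}|`, `|A − b| = |ϖ^{N₊}|` (type A) `↦ |D − b| = |ϖ^{N₊}|`.  CONCLUSIONS BYTE-IDENTICAL to ★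
(`Nat.card {…} = 0`, `= F * ((q ^ (m - (m - N / 2)) * (q ^ (m - 1) * (q + 1))) * q ^ (m - (m - N / 2)))`, `(… : ℚ) = iThirteen q N Np M m`).  THEOREMS ONLY: no definition, no named
fact, no instance, no notation, no `sorry`; kernel lane.
* §1 `borel_coords_of_mem_flickerPH'` — the Borel coordinates are read off the matrix (datum-free, over ★ (i)).
* §2 the regimes as coset counts: (R-kill) `natCard_cosets_jzero_eq_zero_of_v_lt_of_rel` (★ FILE 2 `not_condition_four_of_v_sub_sub_lt_normForm`), (R-far)
  `…_eq_zero_of_far_of_rel` (★ FILE 1 `v_mul_le_sq_of_corner_four_trace`), (R-ce, odd) `…_eq_zero_of_odd_of_rel` (★ FILE 1 `corner_four_iff_norm_sub_le_trace` +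
  `even_of_norm_sub_le_of_near_trace`), (R-bd) `natCard_cosets_jzero_bd_of_rel` (★ FILE 1 `corner_four_iff_box_of_bounded_trace` + `conditions_two_three_of_v_le_jzero_trace` +
  `natCard_cosets_of_iff_box_of_unram`).
* `conj_mem_flickerHK_iff_norm_sub_le_of_rel` — the pointwise case-(e) criterion in the `X`-shape (`|XσX − C| ≤ |ϖ^{2m−N}|`), discharged from the congruence system.
The dispatch `natCard_cosets_jzero_eq_iThirteen_of_lt_of_rel` (+ ED. 2) is the SEQUEL `UnitOrbitalIntegralInertCountJZeroLargeDispatchTrace` (400-line rule).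
FINDING #19 status (census (6)): every cell of the half `m > N` is residue-characteristic-clean (boxes, strict dominations, parity; `ℓ ≥ 1` forced in (R-ce)); this file
asserts no dyadic equidistant-row value.  HONEST LABEL: HC_CM is proved only modulo the printed citations (hLiu418, h413) until rung 0 closes; this file is a finite count
and proves no letter (count-neutral, (D-UNR) PRINT).

## References
* [Flicker1998UnitaryFL] Y. Z. Flicker, *Elementary proof of the fundamental lemma for a unitary group*, Canad. J. Math. 50 (1998): Prop. 13 pp. 91–93, Prop. 8 p. 84.
* [Rogawski1990] J. D. Rogawski, *Automorphic Representations of Unitary Groups in Three Variables* (1990), §4.9 p. 55.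
-/

set_option autoImplicit false

open scoped MatrixGroups WithZero Valued
open Matrix

namespace Literature.NumberTheory.Automorphic

namespace UnitaryGroup

open Literature.NumberTheory.Automorphic.HermitianLattice (unitaryInt mem_unitaryInt_iff UnramifiedLocalConjDatum)
open IsLocalRing

variable {K : Type*} [Field K] [Valued K ℤᵐ⁰] {ϖ : K} (σ : K →+* K) {J : Matrix (Fin 3) (Fin 3) K}

/-! ## §1 The Borel coordinates of `p ∈ P_H` are determined by its matrix (datum-free) -/

/-- If `p ∈ P_H` has matrix `!![u,0,u·x; 0,w,0; 0,0,(σu)⁻¹]` then `u` is a unit, `x` is integral anti-fixed and `w` is a norm-one unit — over ANY isometric involution `σ`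
and `(2 : K) ≠ 0` (twin of ★ `borel_coords_of_mem_flickerPH`, read off ★ (i) `exists_coe_eq_borel_of_mem_flickerPH'`). [cite: Flicker1998UnitaryFL, Prop. 8 p. 84] -/
theorem borel_coords_of_mem_flickerPH' (hJ : J = (StdForm.antidiagonal 3).over K)
    (hσσ : ∀ a, σ (σ a) = a) (hvσ : ∀ a, Valued.v (σ a) = Valued.v a) (h2 : (2 : K) ≠ 0)
    {c p : ↥(unitaryGroupOfForm σ J)} (hc : ((c : GL (Fin 3) K) : Matrix (Fin 3) (Fin 3) K) = !![1, 0, 0; 0, -1, 0; 0, 0, 1])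
    (hp : p ∈ flickerPH σ J c) {u x w : K} (hpm : ((p : GL (Fin 3) K) : Matrix (Fin 3) (Fin 3) K) = !![u, 0, u * x; 0, w, 0; 0, 0, (σ u)⁻¹]) :
    Valued.v u = 1 ∧ Valued.v x ≤ 1 ∧ σ x = -x ∧ Valued.v w = 1 ∧ σ w * w = 1 := by
  obtain ⟨u', x', w', hpm', hvu, hvx, hσx, hvw, hσw⟩ := exists_coe_eq_borel_of_mem_flickerPH' σ hJ hσσ hvσ h2 hc hp
  have h00 := congrFun (congrFun (hpm.symm.trans hpm') 0) 0
  have h02 := congrFun (congrFun (hpm.symm.trans hpm') 0) 2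
  have h11 := congrFun (congrFun (hpm.symm.trans hpm') 1) 1
  simp only [of_apply, cons_val', cons_val_zero, cons_val_one, cons_val_two, empty_val', cons_val_fin_one] at h00 h02 h11
  have hu0 : u' ≠ 0 := fun h => by rw [h, map_zero] at hvu; exact zero_ne_one hvu
  subst h00
  have hx : x = x' := mul_left_cancel₀ hu0 h02
  subst hx
  subst h11
  exact ⟨hvu, hvx, hσx, hvw, hσw⟩

/-! ## §2 The coset counts of the `j = 0` regimes, trace frame -/

/-- The trace-fibre constant: for `σx = −x`, `z + σz + yσy = 0` and `w = x + z` one has `w + σw = −(yσy)`, a `σ`-fixed unit when `|y| = 1`.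
[cite: Flicker1998UnitaryFL, Prop. 10 p. 86] -/
theorem add_map_eq_neg_norm_of_rel (hvσ : ∀ a, Valued.v (σ a) = Valued.v a) {y z x : K} (hy : Valued.v y = 1) (hz : z + σ z + y * σ y = 0)
    (hσx : σ x = -x) : (x + z) + σ (x + z) = -(y * σ y) ∧ Valued.v (-(y * σ y)) = 1 := by
  refine ⟨by rw [map_add, hσx]; linear_combination hz, ?_⟩
  rw [Valuation.map_neg, map_mul, hvσ, hy, mul_one]

/-- **(R-kill) as a coset count, trace frame** (type A: `N₊ < N`, `N₊ < 2m`): if `|A − D| < |D − b|`, `|B₂| < |D − b|` and `|t|² < |D − b|` (with `B₁ = B₂·p`, `|p| ≤ 1`),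
NO coset conjugates `τ` into `H^K_m` — on the trace fibre the linear term `(A − b)w + (D − b)σw = (A − D)w + (D − b)s` has valuation EXACTLY `|D − b|` for every coset
(★ FILE 2 `not_condition_four_of_v_sub_sub_lt_normForm`; twin of ★ `natCard_cosets_jzero_eq_zero_of_v_lt`). [cite: Flicker1998UnitaryFL, Prop. 13 p. 93] -/
theorem natCard_cosets_jzero_eq_zero_of_v_lt_of_rel (hJ : J = (StdForm.antidiagonal 3).over K) (hd : UnramifiedLocalConjDatum σ ϖ) (h2 : (2 : K) ≠ 0)
    {y z : K} (hy : Valued.v y = 1) (hzv : Valued.v z ≤ 1) (hz : z + σ z + y * σ y = 0) (m : ℕ)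
    {c um τ : ↥(unitaryGroupOfForm σ J)} (hc : ((c : GL (Fin 3) K) : Matrix (Fin 3) (Fin 3) K) = !![1, 0, 0; 0, -1, 0; 0, 0, 1])
    (hum : ((um : GL (Fin 3) K) : Matrix (Fin 3) (Fin 3) K) = !![ϖ ^ m, y, z * (ϖ ^ m)⁻¹; 0, 1, -σ y * (ϖ ^ m)⁻¹; 0, 0, (ϖ ^ m)⁻¹])
    {A B₁ B₂ D b p : K} (hB₁ : B₁ = B₂ * p) (hvp : Valued.v p ≤ 1)
    (hτ : ((τ : GL (Fin 3) K) : Matrix (Fin 3) (Fin 3) K) = !![A, 0, B₁; 0, b, 0; B₂, 0, D])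
    (hτH : τ ∈ Subgroup.centralizer ({c} : Set ↥(unitaryGroupOfForm σ J)))
    (hAD : Valued.v (A - D) < Valued.v (D - b)) (hB₂s : Valued.v B₂ < Valued.v (D - b))
    (hts : Valued.v (ϖ ^ m) * Valued.v (ϖ ^ m) < Valued.v (D - b)) :
    Nat.card {w : ↥(flickerPH σ J c) ⧸ (flickerHK σ J c um).subgroupOf (flickerPH σ J c) //
      ((Quotient.out w : ↥(flickerPH σ J c)) : ↥(unitaryGroupOfForm σ J))⁻¹ * τ * (Quotient.out w : ↥(flickerPH σ J c)) ∈ flickerHK σ J c um} = 0 := by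
  refine natCard_cosets_eq_zero_of_forall_coord_not σ hJ hd.σσ hd.vσ h2 hc fun p hp u x w₀ hpm hvu hvx hσx hvw _ hmem => ?_
  have hu0 : u ≠ 0 := fun h => by rw [h, map_zero] at hvu; exact zero_ne_one hvu
  have hσu0 : σ u ≠ 0 := fun h => hu0 (by rw [← hd.σσ u, h, map_zero])
  have hw0 : w₀ ≠ 0 := fun h => by rw [h, map_zero] at hvw; exact zero_ne_one hvw
  have hpH : p ∈ Subgroup.centralizer ({c} : Set ↥(unitaryGroupOfForm σ J)) := ((mem_flickerPH_iff h2 hc).1 hp).1.1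
  obtain ⟨-, -, -, h₄⟩ := (borel_conj_mem_flickerHK_iff_of_rel_normForm σ hJ hd hy hz m hu0 hσu0 hw0 hσx hum hpm hτ hpH hτH rfl).1 hmem
  have hn : Valued.v (u * σ u) = 1 := by rw [map_mul, hd.vσ, hvu, mul_one]
  obtain ⟨hwv, -, -, -, -⟩ := trace_fibre_coord σ hd hy hzv hz hvx hσx
  obtain ⟨hws, hs⟩ := add_map_eq_neg_norm_of_rel σ hd.vσ hy hz hσx
  exact not_condition_four_of_v_sub_sub_lt_normForm σ hd hn hws hs hwv hB₁ hvp hAD hB₂s hts h₄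

/-- **(R-far) as a coset count, trace frame** (`2m > M + N`): if `|t|² < |B₂|·|G − σG|`, NO coset conjugates `τ` into `H^K_m` — (4′) forces `|B₂|·|G − σG| ≤ |t|²`
(★ FILE 1 `v_mul_le_sq_of_corner_four_trace`, the `S − σS` trick, no `|2|`; twin of ★ `natCard_cosets_jzero_eq_zero_of_far`). [cite: Flicker1998UnitaryFL, Prop. 13 p. 92] -/
theorem natCard_cosets_jzero_eq_zero_of_far_of_rel (hJ : J = (StdForm.antidiagonal 3).over K) (hd : UnramifiedLocalConjDatum σ ϖ) (h2 : (2 : K) ≠ 0)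
    {y z : K} (hy : Valued.v y = 1) (hz : z + σ z + y * σ y = 0) (m : ℕ)
    {c um τ : ↥(unitaryGroupOfForm σ J)} (hc : ((c : GL (Fin 3) K) : Matrix (Fin 3) (Fin 3) K) = !![1, 0, 0; 0, -1, 0; 0, 0, 1])
    (hum : ((um : GL (Fin 3) K) : Matrix (Fin 3) (Fin 3) K) = !![ϖ ^ m, y, z * (ϖ ^ m)⁻¹; 0, 1, -σ y * (ϖ ^ m)⁻¹; 0, 0, (ϖ ^ m)⁻¹])
    {A B₁ B₂ D b κ b₀ G r s : K} (hs : s = -(y * σ y)) (htr : κ + σ κ ≠ 0) (hb₀ : b₀ + σ b₀ = 1)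
    (hB₁ : B₁ = κ * σ κ * B₂) (hAD : A - D = (σ κ - κ) * B₂) (hG : B₂ * G = (D - b - κ * B₂) * s) (hr : r * (κ + σ κ) = b₀ * G + σ b₀ * σ G)
    (hB₂0 : B₂ ≠ 0)
    (hτ : ((τ : GL (Fin 3) K) : Matrix (Fin 3) (Fin 3) K) = !![A, 0, B₁; 0, b, 0; B₂, 0, D])
    (hτH : τ ∈ Subgroup.centralizer ({c} : Set ↥(unitaryGroupOfForm σ J)))
    (hfar : Valued.v (ϖ ^ m) * Valued.v (ϖ ^ m) < Valued.v B₂ * Valued.v (G - σ G)) :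
    Nat.card {w : ↥(flickerPH σ J c) ⧸ (flickerHK σ J c um).subgroupOf (flickerPH σ J c) //
      ((Quotient.out w : ↥(flickerPH σ J c)) : ↥(unitaryGroupOfForm σ J))⁻¹ * τ * (Quotient.out w : ↥(flickerPH σ J c)) ∈ flickerHK σ J c um} = 0 := by
  refine natCard_cosets_eq_zero_of_forall_coord_not σ hJ hd.σσ hd.vσ h2 hc fun p hp u x w₀ hpm hvu hvx hσx hvw _ hmem => ?_
  have hu0 : u ≠ 0 := fun h => by rw [h, map_zero] at hvu; exact zero_ne_one hvu
  have hσu0 : σ u ≠ 0 := fun h => hu0 (by rw [← hd.σσ u, h, map_zero])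
  have hw0 : w₀ ≠ 0 := fun h => by rw [h, map_zero] at hvw; exact zero_ne_one hvw
  have hpH : p ∈ Subgroup.centralizer ({c} : Set ↥(unitaryGroupOfForm σ J)) := ((mem_flickerPH_iff h2 hc).1 hp).1.1
  obtain ⟨-, -, -, h₄⟩ := (borel_conj_mem_flickerHK_iff_of_rel_normForm σ hJ hd hy hz m hu0 hσu0 hw0 hσx hum hpm hτ hpH hτH rfl).1 hmem
  have hn : Valued.v (u * σ u) = 1 := by rw [map_mul, hd.vσ, hvu, mul_one]
  have hσn : σ (u * σ u) = u * σ u := by rw [map_mul, hd.σσ, mul_comm]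
  have hws : (x + z) + σ (x + z) = s := by rw [hs]; exact (add_map_eq_neg_norm_of_rel σ hd.vσ hy hz hσx).1
  have key := v_mul_le_sq_of_corner_four_trace σ hd (b := b) hB₂0 hn hσn hws htr hb₀ hB₁ hAD hG hr h₄
  exact absurd hfar (not_lt.2 key)

/-- **(R-ce) with ODD `ord C`: no coset, trace frame** (`C = r(s + r)`; cases (c)∕(e) when `M − N` is odd): in the norm-residue regime `|B₂| = |ϖ^N|`, `N ≤ 2m`,
`|G − σG| ≤ |ϖ^{2m−N}| < |C|`, a coset conjugating `τ` into `H^K_m` would solve `|XσX − C| ≤ |ϖ^{2m−N}|`, forcing `ord C` EVEN (★ FILE 1 `corner_four_iff_norm_sub_le_trace`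
+ `even_of_norm_sub_le_of_near_trace`; twin of ★ `natCard_cosets_jzero_eq_zero_of_odd`). [cite: Flicker1998UnitaryFL, Prop. 13 (c)(e) pp. 92–93] -/
theorem natCard_cosets_jzero_eq_zero_of_odd_of_rel (hJ : J = (StdForm.antidiagonal 3).over K) (hd : UnramifiedLocalConjDatum σ ϖ) (h2 : (2 : K) ≠ 0)
    {y z : K} (hy : Valued.v y = 1) (hz : z + σ z + y * σ y = 0) {m N : ℕ} (hN : N ≤ 2 * m)
    {c um τ : ↥(unitaryGroupOfForm σ J)} (hc : ((c : GL (Fin 3) K) : Matrix (Fin 3) (Fin 3) K) = !![1, 0, 0; 0, -1, 0; 0, 0, 1])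
    (hum : ((um : GL (Fin 3) K) : Matrix (Fin 3) (Fin 3) K) = !![ϖ ^ m, y, z * (ϖ ^ m)⁻¹; 0, 1, -σ y * (ϖ ^ m)⁻¹; 0, 0, (ϖ ^ m)⁻¹])
    {A B₁ B₂ D b κ b₀ G r s : K} (hs : s = -(y * σ y)) (htr : κ + σ κ ≠ 0) (hb₀ : b₀ + σ b₀ = 1) (hb₀v : Valued.v b₀ ≤ 1)
    (hB₁ : B₁ = κ * σ κ * B₂) (hAD : A - D = (σ κ - κ) * B₂) (hG : B₂ * G = (D - b - κ * B₂) * s) (hr : r * (κ + σ κ) = b₀ * G + σ b₀ * σ G)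
    (hB : Valued.v B₂ = Valued.v (ϖ ^ N))
    (hτ : ((τ : GL (Fin 3) K) : Matrix (Fin 3) (Fin 3) K) = !![A, 0, B₁; 0, b, 0; B₂, 0, D])
    (hτH : τ ∈ Subgroup.centralizer ({c} : Set ↥(unitaryGroupOfForm σ J)))
    (hΔ : Valued.v (G - σ G) ≤ Valued.v (ϖ ^ (2 * m - N))) (hnear : Valued.v (ϖ ^ (2 * m - N)) < Valued.v (r * (s + r)))
    (hodd : ¬ ∃ e : ℤ, Valued.v (r * (s + r)) = WithZero.exp (2 * e)) :
    Nat.card {w : ↥(flickerPH σ J c) ⧸ (flickerHK σ J c um).subgroupOf (flickerPH σ J c) //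
      ((Quotient.out w : ↥(flickerPH σ J c)) : ↥(unitaryGroupOfForm σ J))⁻¹ * τ * (Quotient.out w : ↥(flickerPH σ J c)) ∈ flickerHK σ J c um} = 0 := by
  refine natCard_cosets_eq_zero_of_forall_coord_not σ hJ hd.σσ hd.vσ h2 hc fun p hp u x w₀ hpm hvu hvx hσx hvw _ hmem => ?_
  have hu0 : u ≠ 0 := fun h => by rw [h, map_zero] at hvu; exact zero_ne_one hvu
  have hσu0 : σ u ≠ 0 := fun h => hu0 (by rw [← hd.σσ u, h, map_zero])
  have hw0 : w₀ ≠ 0 := fun h => by rw [h, map_zero] at hvw; exact zero_ne_one hvw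
  have hpH : p ∈ Subgroup.centralizer ({c} : Set ↥(unitaryGroupOfForm σ J)) := ((mem_flickerPH_iff h2 hc).1 hp).1.1
  obtain ⟨-, -, -, h₄⟩ := (borel_conj_mem_flickerHK_iff_of_rel_normForm σ hJ hd hy hz m hu0 hσu0 hw0 hσx hum hpm hτ hpH hτH rfl).1 hmem
  have hn : Valued.v (u * σ u) = 1 := by rw [map_mul, hd.vσ, hvu, mul_one]
  have hσn : σ (u * σ u) = u * σ u := by rw [map_mul, hd.σσ, mul_comm]
  have hws : (x + z) + σ (x + z) = s := by rw [hs]; exact (add_map_eq_neg_norm_of_rel σ hd.vσ hy hz hσx).1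
  have hsol := (corner_four_iff_norm_sub_le_trace σ hd (b := b) hB hN hn hσn hws htr hb₀ hb₀v hB₁ hAD hG hr hΔ).1 h₄
  exact hodd (even_of_norm_sub_le_of_near_trace σ hd.vσ hnear hsol)


/-- The pointwise CASE-(e) CRITERION in the `X`-shape, discharged from the congruence system: in the norm-residue regime (`|B₂| = |ϖ^N|`, `N ≤ m`, `m ≤ M`,
`2m ≤ M + N`, `|C| = |ϖ^{M−N}| > |ϖ^{2m−N}|`, `|Δ| = |ϖ^M|`) one has, for every `p = p(u,x,w) ∈ P_H`, `p⁻¹ τ p ∈ H^K_m ↔ |XσX − C| ≤ |ϖ^{2m−N}|` with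
`X = κ(uσu)⁻¹ + (x + z) + r` ((4′) by ★ FILE 1 `corner_four_iff_norm_sub_le_trace`; (2′)(3′) by `conditions_two_three_of_v_le_jzero_trace` through `|X| ≤ |ϖ^{m−N}|`,
★ FILE 1 `v_le_pow_of_norm_sub_le_of_near_trace`). [cite: Flicker1998UnitaryFL, Prop. 13 (c)(e) pp. 92–93] -/
theorem conj_mem_flickerHK_iff_norm_sub_le_of_rel (hJ : J = (StdForm.antidiagonal 3).over K) (hd : UnramifiedLocalConjDatum σ ϖ) (h2 : (2 : K) ≠ 0)
    {y z : K} (hy : Valued.v y = 1) (hz : z + σ z + y * σ y = 0) {m N M : ℕ} (hNm : N ≤ m) (hmM : m ≤ M) (hMN : 2 * m ≤ M + N)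
    {c um τ : ↥(unitaryGroupOfForm σ J)} (hc : ((c : GL (Fin 3) K) : Matrix (Fin 3) (Fin 3) K) = !![1, 0, 0; 0, -1, 0; 0, 0, 1])
    (hum : ((um : GL (Fin 3) K) : Matrix (Fin 3) (Fin 3) K) = !![ϖ ^ m, y, z * (ϖ ^ m)⁻¹; 0, 1, -σ y * (ϖ ^ m)⁻¹; 0, 0, (ϖ ^ m)⁻¹])
    {A B₁ B₂ D b κ b₀ G r s : K} (hs : s = -(y * σ y)) (htr : κ + σ κ ≠ 0) (hrv : Valued.v r ≤ 1) (hb₀ : b₀ + σ b₀ = 1) (hb₀v : Valued.v b₀ ≤ 1)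
    (hB₁ : B₁ = κ * σ κ * B₂) (hAD : A - D = (σ κ - κ) * B₂) (hG : B₂ * G = (D - b - κ * B₂) * s) (hr : r * (κ + σ κ) = b₀ * G + σ b₀ * σ G)
    (hB : Valued.v B₂ = Valued.v (ϖ ^ N)) (hCv : Valued.v (r * (s + r)) = Valued.v (ϖ ^ (M - N))) (hGv : Valued.v (G - σ G) = Valued.v (ϖ ^ M))
    (hnear : Valued.v (ϖ ^ (2 * m - N)) < Valued.v (r * (s + r)))
    (hτ : ((τ : GL (Fin 3) K) : Matrix (Fin 3) (Fin 3) K) = !![A, 0, B₁; 0, b, 0; B₂, 0, D])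
    (hτH : τ ∈ Subgroup.centralizer ({c} : Set ↥(unitaryGroupOfForm σ J)))
    {p : ↥(unitaryGroupOfForm σ J)} (hp : p ∈ flickerPH σ J c) {u x w : K}
    (hpm : ((p : GL (Fin 3) K) : Matrix (Fin 3) (Fin 3) K) = !![u, 0, u * x; 0, w, 0; 0, 0, (σ u)⁻¹]) :
    p⁻¹ * τ * p ∈ flickerHK σ J c um ↔
      Valued.v ((κ * (u * σ u)⁻¹ + (x + z) + r) * σ (κ * (u * σ u)⁻¹ + (x + z) + r) - r * (s + r)) ≤ Valued.v (ϖ ^ (2 * m - N)) := by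
  have vle : ∀ {a b : ℕ}, Valued.v (ϖ ^ a) ≤ Valued.v (ϖ ^ b) ↔ b ≤ a := fun {a b} => by
    rw [hd.v_pow, hd.v_pow, WithZero.exp_le_exp]; omega
  obtain ⟨hvu, hvx, hσx, hvw, -⟩ := borel_coords_of_mem_flickerPH' σ hJ hd.σσ hd.vσ h2 hc hp hpm
  have hu0 : u ≠ 0 := fun h => by rw [h, map_zero] at hvu; exact zero_ne_one hvu
  have hσu0 : σ u ≠ 0 := fun h => hu0 (by rw [← hd.σσ u, h, map_zero])
  have hw0 : w ≠ 0 := fun h => by rw [h, map_zero] at hvw; exact zero_ne_one hvw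
  have hpH : p ∈ Subgroup.centralizer ({c} : Set ↥(unitaryGroupOfForm σ J)) := ((mem_flickerPH_iff h2 hc).1 hp).1.1
  have hn : Valued.v (u * σ u) = 1 := by rw [map_mul, hd.vσ, hvu, mul_one]
  have hσn : σ (u * σ u) = u * σ u := by rw [map_mul, hd.σσ, mul_comm]
  obtain ⟨hws, hvs'⟩ := add_map_eq_neg_norm_of_rel σ hd.vσ hy hz hσx
  have hvs : Valued.v s = 1 := by rw [hs]; exact hvs'
  rw [← hs] at hws
  have hΔ2 : Valued.v (G - σ G) ≤ Valued.v (ϖ ^ (2 * m - N)) := by rw [hGv, vle]; omega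
  rw [borel_conj_mem_flickerHK_iff_of_rel_normForm σ hJ hd hy hz m hu0 hσu0 hw0 hσx hum hpm hτ hpH hτH rfl,
    and_iff_right (show Valued.v ((u * σ u) * B₂) ≤ 1 by rw [map_mul, hn, one_mul, hB]; exact hd.v_pow_le_one N)]
  have hiff := corner_four_iff_norm_sub_le_trace σ hd (b := b) hB (by omega) hn hσn hws htr hb₀ hb₀v hB₁ hAD hG hr hΔ2
  constructor
  · rintro ⟨-, -, h₄⟩; exact hiff.1 h₄
  · intro hsol
    have h₄ := hiff.2 hsol
    have hX : Valued.v (κ * (u * σ u)⁻¹ + (x + z) + r) ≤ Valued.v (ϖ ^ (m - N)) :=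
      v_le_pow_of_norm_sub_le_of_near_trace σ hd (k := m - N) hnear (by rw [hCv, vle]; omega) hsol
    obtain ⟨h₂, h₃⟩ := conditions_two_three_of_v_le_jzero_trace σ hd (A := A) (b := b) hn hσn hvs hws htr hrv hb₀ hb₀v hB hNm hG hAD hr
      hX (by rw [hCv, vle]; omega) (le_trans hΔ2 (by rw [vle]; omega))
    exact ⟨h₂, h₃, h₄⟩

section Count

variable [IsDiscreteValuationRing 𝒪[K]] [Finite (ResidueField 𝒪[K])] [IsAdicComplete (maximalIdeal 𝒪[K]) 𝒪[K]]

/-- **(R-bd) as a coset count, trace frame** (cases (b)∕(d): `N ≤ m`, `1 ≤ m`, `|C|, |Δ| ≤ |ϖ^{2m−N}|`, `C = r(s+r)`, `Δ = G − σG`): the conjugation condition is the BOX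
`|ν⁻¹ + w₀| ≤ |ϖ^k| ∧ |x + y₀| ≤ |ϖ^k|`, `k = m − [N∕2]`, where `z + r = κw₀ + y₀` splits the LITERAL constant `z + r` into `κ`·fixed + anti-fixed parts
(★ FILE 1 `corner_four_iff_box_of_bounded_trace` for (4′); (2′)(3′) by `conditions_two_three_of_v_le_jzero_trace`; `|w₀| = 1` by ★ FILE 2 `v_eq_one_of_trace_mul_eq`), so the
count is `F · (q^{m−k}·q^{m−1}(q+1)) · q^{m−k}` by `natCard_cosets_of_iff_box_of_unram` — twin of ★ `natCard_cosets_jzero_bd`, RHS verbatim, every residue characteristic.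
[cite: Flicker1998UnitaryFL, Prop. 13 (b)(d) pp. 91–93] -/
theorem natCard_cosets_jzero_bd_of_rel (hJ : J = (StdForm.antidiagonal 3).over K) (hd : UnramifiedLocalConjDatum σ ϖ) (h2 : (2 : K) ≠ 0)
    (hσO : ∀ y : 𝒪[K], (σ.comp 𝒪[K].subtype) y ∈ 𝒪[K]) {y z : K} (hy : Valued.v y = 1) (hzv : Valued.v z ≤ 1) (hz : z + σ z + y * σ y = 0)
    {m N : ℕ} (hm : 1 ≤ m) (hNm : N ≤ m)
    {c um τ : ↥(unitaryGroupOfForm σ J)} (hc : ((c : GL (Fin 3) K) : Matrix (Fin 3) (Fin 3) K) = !![1, 0, 0; 0, -1, 0; 0, 0, 1])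
    (hum : ((um : GL (Fin 3) K) : Matrix (Fin 3) (Fin 3) K) = !![ϖ ^ m, y, z * (ϖ ^ m)⁻¹; 0, 1, -σ y * (ϖ ^ m)⁻¹; 0, 0, (ϖ ^ m)⁻¹])
    {A B₁ B₂ D b κ b₀ G r s w₀ y₀ : K} (hs : s = -(y * σ y)) (hκ : Valued.v κ ≤ 1) (htr : Valued.v (κ + σ κ) = 1) (hrv : Valued.v r ≤ 1)
    (hb₀ : b₀ + σ b₀ = 1) (hb₀v : Valued.v b₀ ≤ 1)
    (hB₁ : B₁ = κ * σ κ * B₂) (hAD : A - D = (σ κ - κ) * B₂) (hG : B₂ * G = (D - b - κ * B₂) * s) (hr : r * (κ + σ κ) = b₀ * G + σ b₀ * σ G)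
    (hB : Valued.v B₂ = Valued.v (ϖ ^ N)) (hc0 : z + r = κ * w₀ + y₀) (hσw₀ : σ w₀ = w₀) (hσy₀ : σ y₀ = -y₀)
    (hτ : ((τ : GL (Fin 3) K) : Matrix (Fin 3) (Fin 3) K) = !![A, 0, B₁; 0, b, 0; B₂, 0, D])
    (hτH : τ ∈ Subgroup.centralizer ({c} : Set ↥(unitaryGroupOfForm σ J)))
    (hC : Valued.v (r * (s + r)) ≤ Valued.v (ϖ ^ (2 * m - N))) (hΔ : Valued.v (G - σ G) ≤ Valued.v (ϖ ^ (2 * m - N)))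
    {q : ℕ} (hq : Nat.card (ResidueField 𝒪[K]) = q ^ 2)
    {a₀ : 𝒪[K]} (ha₀ : IsUnit (((σ.comp 𝒪[K].subtype).codRestrict 𝒪[K] hσO) a₀ - a₀))
    (hSN : flickerPH σ J c ⊓ flickerHK σ J c um ≤ flickerPH0 σ J c (ϖ ^ m))
    [Finite (↥(flickerPH σ J c) ⧸ (flickerHK σ J c um).subgroupOf (flickerPH σ J c))] {F : ℕ}
    (hfib : ∀ z ∈ Set.range (fun w : ↥(flickerPH σ J c) ⧸ (flickerHK σ J c um).subgroupOf (flickerPH σ J c) =>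
        flickerPHRho σ m ((Quotient.out w : ↥(flickerPH σ J c)) : ↥(unitaryGroupOfForm σ J))),
      Nat.card {w : ↥(flickerPH σ J c) ⧸ (flickerHK σ J c um).subgroupOf (flickerPH σ J c) //
        flickerPHRho σ m ((Quotient.out w : ↥(flickerPH σ J c)) : ↥(unitaryGroupOfForm σ J)) = z} = F) :
    Nat.card {w : ↥(flickerPH σ J c) ⧸ (flickerHK σ J c um).subgroupOf (flickerPH σ J c) //
      ((Quotient.out w : ↥(flickerPH σ J c)) : ↥(unitaryGroupOfForm σ J))⁻¹ * τ * (Quotient.out w : ↥(flickerPH σ J c)) ∈ flickerHK σ J c um} =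
      F * ((q ^ (m - (m - N / 2)) * (q ^ (m - 1) * (q + 1))) * q ^ (m - (m - N / 2))) := by
  have hN : N ≤ 2 * m := by omega
  have htr0 : κ + σ κ ≠ 0 := fun h => by rw [h, map_zero] at htr; exact zero_ne_one htr
  have hσr : σ r = r := map_eq_self_of_mul_trace_eq σ hd.σσ htr0 hr
  have hvs : Valued.v s = 1 := by rw [hs, Valuation.map_neg, map_mul, hd.vσ, hy, mul_one]
  have hzs : z + σ z = s := by rw [hs]; linear_combination hz
  -- `|w₀| = 1`: `(κ + σκ)w₀ = s + 2r` and `|r(s+r)| < 1`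
  have hkw : (κ + σ κ) * w₀ = s + 2 * r := by
    have h := congrArg σ hc0
    rw [map_add, map_add, map_mul, hσr, hσw₀, hσy₀] at h
    linear_combination hzs - hc0 - h
  have hρ1 : Valued.v (ϖ ^ (2 * m - N)) < 1 := by rw [hd.v_pow, ← WithZero.exp_zero, WithZero.exp_lt_exp]; omega
  have hw₀1 : Valued.v w₀ = 1 := v_eq_one_of_trace_mul_eq σ htr hvs hkw (lt_of_le_of_lt hC hρ1)
  have hy₀v : Valued.v y₀ ≤ 1 := by
    have e : y₀ = z + r - κ * w₀ := by linear_combination -hc0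
    rw [e]
    refine le_trans (Valuation.map_sub _ _ _) (max_le (le_trans (Valuation.map_add _ _ _) (max_le hzv hrv)) ?_)
    rw [map_mul, hw₀1, mul_one]; exact hκ
  -- exponent bookkeeping
  have vle : ∀ {a b : ℕ}, Valued.v (ϖ ^ a) ≤ Valued.v (ϖ ^ b) ↔ b ≤ a := fun {a b} => by
    rw [hd.v_pow, hd.v_pow, WithZero.exp_le_exp]; omega
  have hkρ : Valued.v (ϖ ^ (m - N / 2)) ≤ Valued.v (ϖ ^ (m - N)) := by rw [vle]; omega
  have h2ρ : Valued.v (ϖ ^ (2 * m - N)) ≤ Valued.v (ϖ ^ (m - N)) := by rw [vle]; omega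
  refine natCard_cosets_of_iff_box_of_unram σ hJ hd h2 hσO hm (k := m - N / 2) (by omega) (by omega) hc hw₀1 hσw₀ hy₀v hσy₀ ?_ hq ha₀ hSN hfib
  -- the binder `hbd`: criterion ⟺ box
  intro p hp u x wc hpm
  obtain ⟨hvu, hvx, hσx, hvw, -⟩ := borel_coords_of_mem_flickerPH' σ hJ hd.σσ hd.vσ h2 hc hp hpm
  have hu0 : u ≠ 0 := fun h => by rw [h, map_zero] at hvu; exact zero_ne_one hvu
  have hσu0 : σ u ≠ 0 := fun h => hu0 (by rw [← hd.σσ u, h, map_zero])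
  have hw0 : wc ≠ 0 := fun h => by rw [h, map_zero] at hvw; exact zero_ne_one hvw
  have hpH : p ∈ Subgroup.centralizer ({c} : Set ↥(unitaryGroupOfForm σ J)) := ((mem_flickerPH_iff h2 hc).1 hp).1.1
  have hn : Valued.v (u * σ u) = 1 := by rw [map_mul, hd.vσ, hvu, mul_one]
  have hσn : σ (u * σ u) = u * σ u := by rw [map_mul, hd.σσ, mul_comm]
  have hws : (x + z) + σ (x + z) = s := by rw [hs]; exact (add_map_eq_neg_norm_of_rel σ hd.vσ hy hz hσx).1
  rw [borel_conj_mem_flickerHK_iff_of_rel_normForm σ hJ hd hy hz m hu0 hσu0 hw0 hσx hum hpm hτ hpH hτH rfl,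
    and_iff_right (show Valued.v ((u * σ u) * B₂) ≤ 1 by rw [map_mul, hn, one_mul, hB]; exact hd.v_pow_le_one N)]
  have hbox := corner_four_iff_box_of_bounded_trace σ hd (b := b) hB hN hn hσn hws hκ htr hb₀ hb₀v hB₁ hAD hG hr hC hΔ rfl hσx hc0 hσw₀ hσy₀
  constructor
  · rintro ⟨-, -, h₄⟩
    exact hbox.1 h₄
  · intro hb
    have h₄ := hbox.2 hb
    -- `|X| ≤ |ϖ^{m−N}|` from the box: `X = κ(ν⁻¹ + w₀) + (x + y₀)`
    have hX : Valued.v (κ * (u * σ u)⁻¹ + (x + z) + r) ≤ Valued.v (ϖ ^ (m - N)) := by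
      have e : κ * (u * σ u)⁻¹ + (x + z) + r = κ * ((u * σ u)⁻¹ + w₀) + (x + y₀) := by linear_combination hc0
      rw [e]
      refine le_trans (Valuation.map_add _ _ _) (max_le ?_ (le_trans hb.2 hkρ))
      rw [map_mul]; exact le_trans (mul_le_mul' hκ (le_trans hb.1 hkρ)) (by rw [one_mul])
    obtain ⟨h₂, h₃⟩ := conditions_two_three_of_v_le_jzero_trace σ hd (A := A) (b := b) hn hσn hvs hws htr0 hrv hb₀ hb₀v hB hNm hG hAD hr
      hX (le_trans hC h2ρ) (le_trans hΔ h2ρ)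
    exact ⟨h₂, h₃, h₄⟩

end Count

end UnitaryGroup

end Literature.NumberTheory.Automorphic
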